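import Literature.NumberTheory.EllipticCurves.NewformsLinearIndependenceProofs
import Literature.NumberTheory.EllipticCurves.ModularCurveSturmProofs
import HarnessLib

/-!
# There are finitely many newforms of given level `Γ₀(N)` and weight (`Newforms`, continued):
# discharge of `finite_newforms0`

D-0014 keeps `Literature/` sorry-free by stating cited results as named facts `def X : Prop`.
This sibling file of `Literature.NumberTheory.EllipticCurves.Newforms` discharges the named fact
`finite_newforms0 N k` (Atkin–Lehner 1970, Thm. 5; Diamond–Shurman Thm. 5.8.3: the newforms form a
basis of the finite-dimensional new subspace) as `theorem finite_newforms0_holds`, from two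
results already in the tree: the newforms of level `Γ₀(N)` and weight `k` are linearly independent
(`linearIndependent_newforms0_holds`, `NewformsLinearIndependenceProofs`; Diamond–Shurman, proof
of Thm. 5.8.2) and `S_k(Γ₀(N))` is finite-dimensional (`finiteDimensional_cuspForm_gamma0`,
`ModularCurveSturmProofs`, Sturm's bound); a linearly independent subset of a Noetherian module is
finite (Mathlib `LinearIndependent.set_finite_of_isNoetherian`).

## References

* F. Diamond, J. Shurman, *A first course in modular forms*, GTM 228, Springer 2005, Thm. 5.8.2,
  Thm. 5.8.3 (PDF pp. 217–218). doi:10.1007/978-0-387-27226-9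
* A. O. L. Atkin, J. Lehner, *Hecke operators on `Γ₀(m)`*, Math. Ann. 185 (1970), 134–160, Thm. 5.
-/

noncomputable section

open scoped MatrixGroups ModularForm

open CongruenceSubgroup

namespace Literature.NumberTheory.EllipticCurves.ModularForms

variable (N : ℕ) [NeZero N] (k : ℤ)

/-- **Discharge of `finite_newforms0`**: the set of newforms in `S_k(Γ₀(N))` is finite
(Atkin–Lehner 1970, Thm. 5; Diamond–Shurman Thm. 5.8.3, "The set of newforms in the space
`S_k(Γ₁(N))^{new}` is an orthogonal basis of the space", cf. Thm. 5.8.2, PDF p. 217) — a linearly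
independent subset (`linearIndependent_newforms0_holds`) of the finite-dimensional space
`S_k(Γ₀(N))` (`finiteDimensional_cuspForm_gamma0`) is finite. [cite: DiamondShurman2005, Thm. 5.8.2] -/
theorem finite_newforms0_holds : finite_newforms0 N k := by
  haveI := finiteDimensional_cuspForm_gamma0 N k
  exact (linearIndependent_newforms0_holds N k).set_finite_of_isNoetherian

/-- The newforms of level `Γ₀(N)` and weight `k` as a `Finset`: the coercion of
`(finite_newforms0_holds N k).toFinset` is `newforms0 N k`. [folklore] -/
theorem coe_toFinset_newforms0 :
    ((finite_newforms0_holds N k).toFinset : Set (CuspForm (Gamma0 N) k)) = newforms0 N k :=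
  Set.Finite.coe_toFinset _

end Literature.NumberTheory.EllipticCurves.ModularForms

end
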